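import Summits.CriticalPhenomena.SAWScalingLimit.Theorems.SAWDefectDecoherenceBoundaryClosureRGateMassLawsReduction
import HarnessLib

/-!
# Crux `BoundaryClosureR` (stmt-CriticalPhenomena-14004), line `pick-half-plane`:
the flat mass laws `stub_flatMassLaws` (skeleton r3) from two POINTWISE laws

Landing target:
`Summits/CriticalPhenomena/SAWScalingLimit/Theorems/SAWDefectDecoherenceBoundaryClosureRFlatMassLaws.lean`
(`--supports stmt-CriticalPhenomena-14004`).

The reshaped stub `stub_flatMassLaws : FlatMassLaws` of the line asks, for the `σ = 0` arrival masses
`Z_δ = ‖F_{Λ δ, e δ, x_c, 0}‖` from a pinned flat root `x`: (a) the UNIFORM-IN-SCALE DENSITY law on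
both flat pieces — for a ball `closedBall y ρ₀` inside the pinned ball of the gate piece (centre
`pt 1`, rows `m δ`) or of the root's own piece (centre `x`, rows `mr δ`), at distance `> 2ρ₀` from
the root, ONE constant `C` with `C⁻¹ ρ' Z_δ(b_δ) ≤ δ Σ_{e' ∈ ∂Λ_δ, δ·mid e' ∈ ball y ρ'} Z_δ(e') ≤
C ρ' Z_δ(b_δ)` eventually, for every `ρ' ≤ ρ₀`; (b) the root-arm divergence (unchanged).  Here:

* `density_of_pointwise_at` / `density_of_pointwise`: on a pinned piece, POINTWISE two-sided
  comparability `C⁻¹ Z_δ(b_δ) ≤ Z_δ(floorEdge k) ≤ C Z_δ(b_δ)` of the columns of `ball y ρ₀` implies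
  the density law with the constant `3C`, uniformly in `ρ' ≤ ρ₀` (window identification of
  `…GateMassLaws.lean` + the column count of `…GateMassLawsReduction.lean`: between `ρ'/(2δ)` and
  `3ρ'/δ` columns once the floor row is within `ρ'/2` of the line), for ARBITRARY nonnegative weights;
* **`stub_flatMassLaws_densityReduction`** (registered sub-goal, data level): (a**) pointwise
  comparability on both pieces implies the density law (a) of `FlatMassLaws`;
* **`flatMassLaws_of_pointwise_of_arm`** (family level, verbatim the body of
  `…PickHalfPlane.FlatMassLaws` as conclusion): the flat mass laws follow from (a**) and the root-arm
  divergence (b) verbatim — compose with `armDivergence_family` of the sibling file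
  `…GateMassLawsArm.lean` to replace (b) by the pointwise harmonic arm bound (b*) (the composed glue
  `flatMassLaws_of_pointwise : (a**) → (b*) → FlatMassLaws` is the file `…FlatMassLawsGlue.lean`).

What remains OPEN: (a**) and (b*), boundary-Harnack-type statements for the critical SAW.
Sources: H. Duminil-Copin, S. Smirnov, Ann. of Math. 175 (2012), §3.
-/

noncomputable section

open scoped BigOperators Topology
open Filter Set
open Literature.Probability.LatticeModels (HexVertex hexGraph hexCenter Site)
open Literature.Probability.RandomPlanarGeometry
open Literature.Probability.RandomPlanarGeometry.SAW

namespace Summit.CriticalPhenomena.SAWScalingLimit.Theorems.PickHalfPlane.GateMass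

/-! ### 12. The density law from pointwise comparability, uniformly in the scale -/

/-- **Pointwise ⟹ density, at one mesh.**  At a mesh `0 < δ < ρ'/2`: if the lattice pin holds at `c`
(radius `ρ`), the ball `ball y ρ'` is `δ/2`-deep in the pinned ball, the floor line of the threshold
row `m` is within `ρ'/2` of the height of `y`, and every floor mid-edge of the row `m` with scaled
midpoint in `ball y ρ'` has weight in `[C⁻¹ Z_b, C Z_b]` (`Z ≥ 0`, `Z_b ≥ 0`), then
`(ρ'/(2C)) Z_b ≤ δ Σ_{e' ∈ ∂Λ, δ·mid e' ∈ ball y ρ'} Z(e') ≤ 3 C ρ' Z_b` (between `ρ'/(2δ)` and `3ρ'/δ`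
columns). [cite: DuminilCopinSmirnov2012, §3 (the boundary part α of the strip)] -/
theorem density_of_pointwise_at {Λ : Finset HexVertex} {m : ℤ} {δ ρ ρ' C Zb : ℝ} {c y : ℂ}
    {Z : Sym2 HexVertex → ℝ} (hδ : 0 < δ) (hδρ' : δ < ρ' / 2) (hρ' : 0 < ρ') (hC : 0 < C)
    (hpin : ∀ v : HexVertex, (δ : ℂ) * hexCenter v ∈ Metric.ball c ρ → (v ∈ Λ ↔ m ≤ v.1 1))
    (hS : ∀ z ∈ Metric.ball y ρ', dist z c + δ / 2 < ρ)
    (hheight : |δ * (m : ℝ) * (Real.sqrt 3 / 2) - y.im| < ρ' / 2)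
    (hZ : ∀ e, 0 ≤ Z e) (hZb : 0 ≤ Zb)
    (hpt : ∀ k : ℤ, (δ : ℂ) * hexMidpoint s((((![k, m - 1] : Site 2)), (1 : Fin 2)), ((![k, m] : Site 2), (0 : Fin 2))) ∈ Metric.ball y ρ' →
      C⁻¹ * Zb ≤ Z s((((![k, m - 1] : Site 2)), (1 : Fin 2)), ((![k, m] : Site 2), (0 : Fin 2))) ∧ Z s((((![k, m - 1] : Site 2)), (1 : Fin 2)), ((![k, m] : Site 2), (0 : Fin 2))) ≤ C * Zb) :
    ρ' / (2 * C) * Zb ≤ δ * ∑ᶠ e' ∈ {e' : Sym2 HexVertex |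
        e' ∈ hexDomainBoundary Λ ∧ (δ : ℂ) * hexMidpoint e' ∈ Metric.ball y ρ'}, Z e' ∧
      δ * ∑ᶠ e' ∈ {e' : Sym2 HexVertex |
        e' ∈ hexDomainBoundary Λ ∧ (δ : ℂ) * hexMidpoint e' ∈ Metric.ball y ρ'}, Z e' ≤
        3 * C * ρ' * Zb := by
  -- abbreviations
  set fe : ℤ → Sym2 HexVertex := fun k => s((((![k, m - 1] : Site 2)), (1 : Fin 2)), ((![k, m] : Site 2), (0 : Fin 2))) with hfe
  set K : Set ℤ := {k : ℤ | (δ : ℂ) * hexMidpoint (fe k) ∈ Metric.ball y ρ'} with hK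
  have hWδ := boundaryWindow_eq_image (S := Metric.ball y ρ') hδ.le hpin hS
  have hsum : ∑ᶠ e' ∈ {e' : Sym2 HexVertex | e' ∈ hexDomainBoundary Λ ∧
      (δ : ℂ) * hexMidpoint e' ∈ Metric.ball y ρ'}, Z e' = ∑ᶠ k ∈ K, Z (fe k) := by
    rw [hWδ, finsum_mem_image (floorEdge_injective m).injOn]
  have hKfin : K.Finite := finite_intWindow (S := Metric.ball y ρ') hδ.le hpin hS
  rw [hsum, finsum_mem_eq_finite_toFinset_sum _ hKfin]
  -- real and imaginary parts of the scaled floor midpoints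
  set sδ : ℝ := (m : ℝ) / 2 + 1 / 2 with hsδ
  have hre : ∀ k : ℤ, ((δ : ℂ) * hexMidpoint (fe k)).re = δ * (k + sδ) := by
    intro k
    rw [Complex.mul_re, Complex.ofReal_re, Complex.ofReal_im, zero_mul, sub_zero, hfe,
      re_hexMidpoint_floorEdge', hsδ]
    ring
  have him : ∀ k : ℤ, ((δ : ℂ) * hexMidpoint (fe k)).im = δ * (m : ℝ) * (Real.sqrt 3 / 2) := by
    intro k
    rw [Complex.mul_im, Complex.ofReal_re, Complex.ofReal_im, zero_mul, add_zero, hfe,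
      im_hexMidpoint_floorEdge']
    ring
  -- inner and outer integer intervals
  set I₁ : Finset ℤ := Finset.Icc ⌈(y.re - ρ' / 2) / δ - sδ⌉ ⌊(y.re + ρ' / 2) / δ - sδ⌋ with hI₁
  set I₂ : Finset ℤ := Finset.Icc ⌈(y.re - ρ') / δ - sδ⌉ ⌊(y.re + ρ') / δ - sδ⌋ with hI₂
  have hI₁K : I₁ ⊆ hKfin.toFinset := by
    intro k hk
    rw [Set.Finite.mem_toFinset, hK, Set.mem_setOf_eq, Metric.mem_ball, Complex.dist_eq,
      Complex.norm_def, Complex.normSq_apply, Complex.sub_re, Complex.sub_im, hre, him]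
    have h1 : |δ * (k + sδ) - y.re| ≤ ρ' / 2 := abs_le_of_mem_Icc hδ hk
    have h2 : (δ * (↑k + sδ) - y.re) * (δ * (↑k + sδ) - y.re) +
        (δ * (m : ℝ) * (Real.sqrt 3 / 2) - y.im) * (δ * (m : ℝ) * (Real.sqrt 3 / 2) - y.im) <
          ρ' * ρ' := by
      rw [abs_le] at h1
      rw [abs_lt] at hheight
      nlinarith
    calc Real.sqrt ((δ * (↑k + sδ) - y.re) * (δ * (↑k + sδ) - y.re) +
          (δ * (m : ℝ) * (Real.sqrt 3 / 2) - y.im) * (δ * (m : ℝ) * (Real.sqrt 3 / 2) - y.im))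
        < Real.sqrt (ρ' * ρ') :=
          Real.sqrt_lt_sqrt (add_nonneg (mul_self_nonneg _) (mul_self_nonneg _)) h2
      _ = ρ' := Real.sqrt_mul_self hρ'.le
  have hKI₂ : hKfin.toFinset ⊆ I₂ := by
    intro k hk
    rw [Set.Finite.mem_toFinset, hK, Set.mem_setOf_eq, Metric.mem_ball] at hk
    refine mem_Icc_of_abs_lt hδ (lt_of_le_of_lt ?_ hk)
    rw [← hre, ← Complex.sub_re, Complex.dist_eq]
    exact Complex.abs_re_le_norm _
  -- pointwise bounds on the window
  have hlow : ∀ k ∈ hKfin.toFinset, C⁻¹ * Zb ≤ Z (fe k) := fun k hk =>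
    (hpt k (hKfin.mem_toFinset.1 hk)).1
  have hup : ∀ k ∈ hKfin.toFinset, Z (fe k) ≤ C * Zb := fun k hk =>
    (hpt k (hKfin.mem_toFinset.1 hk)).2
  have hcard₁ : 2 * (ρ' / 2) / δ - 1 ≤ (I₁.card : ℝ) := le_card_Icc δ sδ y.re (ρ' / 2)
  have hcard₂ : (I₂.card : ℝ) ≤ 2 * ρ' / δ + 1 := card_Icc_le hδ hρ'.le
  constructor
  · -- lower bound: at least `ρ'/(2δ)` columns, each of weight `≥ C⁻¹ Z_b`
    have h1 : (I₁.card : ℝ) * (C⁻¹ * Zb) ≤ ∑ k ∈ hKfin.toFinset, Z (fe k) := by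
      calc (I₁.card : ℝ) * (C⁻¹ * Zb) = ∑ k ∈ I₁, C⁻¹ * Zb := by
            rw [Finset.sum_const, nsmul_eq_mul]
        _ ≤ ∑ k ∈ I₁, Z (fe k) := Finset.sum_le_sum fun k hk => hlow k (hI₁K hk)
        _ ≤ ∑ k ∈ hKfin.toFinset, Z (fe k) :=
            Finset.sum_le_sum_of_subset_of_nonneg hI₁K fun _ _ _ => hZ _
    have h2 : ρ' / (2 * δ) ≤ (I₁.card : ℝ) := by
      have e1 : 2 * (ρ' / 2) / δ - 1 = ρ' / δ - 1 := by ring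
      have e2 : ρ' / (2 * δ) = ρ' / δ / 2 := by rw [div_div, mul_comm]
      have h3 : 2 ≤ ρ' / δ := by rw [le_div_iff₀ hδ]; linarith
      rw [e1] at hcard₁
      rw [e2]
      linarith
    calc ρ' / (2 * C) * Zb = δ * (ρ' / (2 * δ) * (C⁻¹ * Zb)) := by
          field_simp
      _ ≤ δ * ((I₁.card : ℝ) * (C⁻¹ * Zb)) := by
          refine mul_le_mul_of_nonneg_left ?_ hδ.le
          exact mul_le_mul_of_nonneg_right h2 (by positivity)
      _ ≤ δ * ∑ k ∈ hKfin.toFinset, Z (fe k) := mul_le_mul_of_nonneg_left h1 hδ.le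
  · -- upper bound: at most `3ρ'/δ` columns, each of weight `≤ C Z_b`
    have h1 : ∑ k ∈ hKfin.toFinset, Z (fe k) ≤ (I₂.card : ℝ) * (C * Zb) := by
      calc ∑ k ∈ hKfin.toFinset, Z (fe k) ≤ ∑ k ∈ hKfin.toFinset, C * Zb :=
            Finset.sum_le_sum hup
        _ = (hKfin.toFinset.card : ℝ) * (C * Zb) := by rw [Finset.sum_const, nsmul_eq_mul]
        _ ≤ (I₂.card : ℝ) * (C * Zb) := by
            refine mul_le_mul_of_nonneg_right ?_ (by positivity)
            exact_mod_cast Finset.card_le_card hKI₂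
    have h2 : δ * (I₂.card : ℝ) ≤ 3 * ρ' := by
      have : δ * (I₂.card : ℝ) ≤ δ * (2 * ρ' / δ + 1) := mul_le_mul_of_nonneg_left hcard₂ hδ.le
      rw [mul_add, mul_div_cancel₀ _ hδ.ne', mul_one] at this
      linarith
    calc δ * ∑ k ∈ hKfin.toFinset, Z (fe k) ≤ δ * ((I₂.card : ℝ) * (C * Zb)) :=
          mul_le_mul_of_nonneg_left h1 hδ.le
      _ = (δ * (I₂.card : ℝ)) * C * Zb := by ring
      _ ≤ (3 * ρ') * C * Zb :=
          mul_le_mul_of_nonneg_right (mul_le_mul_of_nonneg_right h2 hC.le) hZb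
      _ = 3 * C * ρ' * Zb := by ring

/-- **Pointwise ⟹ density, uniformly in the scale.**  Let the lattice pin hold at `c` (radius `ρ > 0`,
rows `m δ`) eventually, let a boundary family `f δ ∈ ∂(Λ δ)` have `δ·mid(f δ) → c` (it pins the floor
height: `f = b` on the gate piece, `f = e` on the root's piece), let `y` be a point of the line through
`c` with `closedBall y ρ₀ ⊆ ball c ρ`, and let `Z δ ≥ 0` be any weights.  If for some `C > 0`,
eventually, every column `floorEdge k (m δ)` with scaled midpoint in `ball y ρ₀` has weight in
`[C⁻¹ Z δ (b δ), C Z δ (b δ)]`, then with the constant `3C`, for EVERY `0 < ρ' ≤ ρ₀`, eventually,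
`(3C)⁻¹ ρ' Z δ (b δ) ≤ δ Σ_{e' ∈ ∂(Λ δ), δ·mid e' ∈ ball y ρ'} Z δ e' ≤ 3C ρ' Z δ (b δ)`.
[cite: DuminilCopinSmirnov2012, §3 (the boundary part α of the strip)] -/
theorem density_of_pointwise {Λ : ℝ → Finset HexVertex} {m : ℝ → ℤ} {ρ ρ₀ : ℝ} {c y : ℂ}
    {b f : ℝ → Sym2 HexVertex} {Z : ℝ → Sym2 HexVertex → ℝ} (hρ : 0 < ρ)
    (hpin : ∀ᶠ δ : ℝ in 𝓝[>] 0, ∀ v : HexVertex,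
      (δ : ℂ) * hexCenter v ∈ Metric.ball c ρ → (v ∈ Λ δ ↔ m δ ≤ v.1 1))
    (hf : ∀ᶠ δ : ℝ in 𝓝[>] 0, f δ ∈ hexDomainBoundary (Λ δ))
    (hlim : Tendsto (fun δ : ℝ => (δ : ℂ) * hexMidpoint (f δ)) (𝓝[>] 0) (𝓝 c))
    (hZ : ∀ δ e', 0 ≤ Z δ e') (hy : y.im = c.im)
    (hball : Metric.closedBall y ρ₀ ⊆ Metric.ball c ρ)
    (hpt : ∃ C : ℝ, 0 < C ∧ ∀ᶠ δ : ℝ in 𝓝[>] 0, ∀ k : ℤ,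
      (δ : ℂ) * hexMidpoint s((((![k, m δ - 1] : Site 2)), (1 : Fin 2)), ((![k, m δ] : Site 2), (0 : Fin 2))) ∈ Metric.ball y ρ₀ →
        C⁻¹ * Z δ (b δ) ≤ Z δ s((((![k, m δ - 1] : Site 2)), (1 : Fin 2)), ((![k, m δ] : Site 2), (0 : Fin 2))) ∧ Z δ s((((![k, m δ - 1] : Site 2)), (1 : Fin 2)), ((![k, m δ] : Site 2), (0 : Fin 2))) ≤ C * Z δ (b δ)) :
    ∃ C : ℝ, 0 < C ∧ ∀ ρ' : ℝ, 0 < ρ' → ρ' ≤ ρ₀ → ∀ᶠ δ : ℝ in 𝓝[>] 0,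
      C⁻¹ * ρ' * Z δ (b δ) ≤ δ * ∑ᶠ e' ∈ {e' : Sym2 HexVertex | e' ∈ hexDomainBoundary (Λ δ) ∧
          (δ : ℂ) * hexMidpoint e' ∈ Metric.ball y ρ'}, Z δ e' ∧
      δ * ∑ᶠ e' ∈ {e' : Sym2 HexVertex | e' ∈ hexDomainBoundary (Λ δ) ∧
          (δ : ℂ) * hexMidpoint e' ∈ Metric.ball y ρ'}, Z δ e' ≤ C * ρ' * Z δ (b δ) := by
  obtain ⟨C, hC, hptC⟩ := hpt
  refine ⟨3 * C, by positivity, fun ρ' hρ' hρ'₀ => ?_⟩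
  -- the floor height is eventually within `ρ'/2` of the line
  have hheight : ∀ᶠ δ : ℝ in 𝓝[>] 0, |δ * (m δ : ℝ) * (Real.sqrt 3 / 2) - y.im| < ρ' / 2 := by
    have h' : ∀ᶠ δ : ℝ in 𝓝[>] 0, dist (δ * (m δ : ℝ) * (Real.sqrt 3 / 2)) c.im < ρ' / 2 :=
      tendsto_floorHeight hρ hpin hf hlim (Metric.ball_mem_nhds _ (half_pos hρ'))
    filter_upwards [h'] with δ hδ
    rwa [Real.dist_eq, ← hy] at hδ
  -- the ball `ball y ρ₀` is eventually `δ/2`-deep in the pinned ball, and `δ < ρ'/2`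
  obtain ⟨ρ₁, hρ₁, hsub⟩ := exists_lt_subset_ball Metric.isClosed_closedBall hball
  have hsmall : ∀ᶠ δ : ℝ in 𝓝[>] 0, 0 < δ ∧ δ < min (ρ' / 2) (ρ - ρ₁) := by
    have h1 : ∀ᶠ δ : ℝ in 𝓝[>] 0, δ ∈ Set.Ioo 0 (min (ρ' / 2) (ρ - ρ₁)) :=
      Ioo_mem_nhdsGT (lt_min (half_pos hρ') (by linarith))
    exact h1
  filter_upwards [hpin, hptC, hheight, hsmall] with δ hpinδ hptδ hhδ hδ
  have hδ1 : δ < ρ' / 2 := lt_of_lt_of_le hδ.2 (min_le_left _ _)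
  have hδ2 : δ < ρ - ρ₁ := lt_of_lt_of_le hδ.2 (min_le_right _ _)
  have hS : ∀ z ∈ Metric.ball y ρ', dist z c + δ / 2 < ρ := by
    intro z hz
    have h1 : z ∈ Metric.closedBall y ρ₀ :=
      Metric.closedBall_subset_closedBall hρ'₀ (Metric.ball_subset_closedBall hz)
    have : dist z c < ρ₁ := hsub h1
    linarith
  have hptδ' : ∀ k : ℤ, (δ : ℂ) * hexMidpoint s((((![k, m δ - 1] : Site 2)), (1 : Fin 2)), ((![k, m δ] : Site 2), (0 : Fin 2))) ∈ Metric.ball y ρ' →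
      C⁻¹ * Z δ (b δ) ≤ Z δ s((((![k, m δ - 1] : Site 2)), (1 : Fin 2)), ((![k, m δ] : Site 2), (0 : Fin 2))) ∧ Z δ s((((![k, m δ - 1] : Site 2)), (1 : Fin 2)), ((![k, m δ] : Site 2), (0 : Fin 2))) ≤ C * Z δ (b δ) :=
    fun k hk => hptδ k (Metric.ball_subset_ball hρ'₀ hk)
  have key := density_of_pointwise_at hδ.1 hδ1 hρ' hC hpinδ hS hhδ (hZ δ) (hZ δ _) hptδ'
  constructor
  · calc (3 * C)⁻¹ * ρ' * Z δ (b δ) ≤ ρ' / (2 * C) * Z δ (b δ) := by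
          refine mul_le_mul_of_nonneg_right ?_ (hZ δ _)
          rw [mul_comm ((3 * C)⁻¹) ρ', ← div_eq_mul_inv, div_le_div_iff₀ (by positivity) (by positivity)]
          nlinarith
      _ ≤ _ := key.1
  · calc _ ≤ 3 * C * ρ' * Z δ (b δ) := key.2
      _ = 3 * C * ρ' * Z δ (b δ) := rfl

/-! ### 13. The flat density law (a) from pointwise comparability on both pieces -/

/-- **Registered sub-goal `stub_flatMassLaws_densityReduction`** (crux item stmt-CriticalPhenomena-14004,
line `pick-half-plane`, stub `stub_flatMassLaws`, DATA LEVEL): for a family pinned at `c` (rows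
`m δ`, normaliser `b δ → c`) and at the root `x` (rows `mr δ`, roots `e δ → x`) and any weights
`Z δ ≥ 0`, (a**) POINTWISE two-sided comparability of the columns of every ball `closedBall y ρ₀` of
either flat piece (at distance `> 2ρ₀` from the root) implies the uniform-in-scale density law (a) of
`FlatMassLaws`. [cite: DuminilCopinSmirnov2012, §3 (the boundary part α of the strip)] -/
theorem stub_flatMassLaws_densityReduction : ∀ (Λ : ℝ → Finset HexVertex) (m mr : ℝ → ℤ) (ρ r : ℝ) (c x : ℂ) (b e : ℝ → Sym2 HexVertex) (Z : ℝ → Sym2 HexVertex → ℝ), 0 < ρ → (∀ᶠ δ : ℝ in 𝓝[>] 0, ∀ v : HexVertex, (δ : ℂ) * hexCenter v ∈ Metric.ball c ρ → (v ∈ Λ δ ↔ m δ ≤ v.1 1)) → (∀ᶠ δ : ℝ in 𝓝[>] 0, b δ ∈ hexDomainBoundary (Λ δ)) → Tendsto (fun δ : ℝ => (δ : ℂ) * hexMidpoint (b δ)) (𝓝[>] 0) (𝓝 c) → 0 < r → (∀ᶠ δ : ℝ in 𝓝[>] 0, ∀ v : HexVertex, (δ : ℂ) * hexCenter v ∈ Metric.ball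 x r → (v ∈ Λ δ ↔ mr δ ≤ v.1 1)) → (∀ᶠ δ : ℝ in 𝓝[>] 0, e δ ∈ hexDomainBoundary (Λ δ)) → Tendsto (fun δ : ℝ => (δ : ℂ) * hexMidpoint (e δ)) (𝓝[>] 0) (𝓝 x) → (∀ δ e', 0 ≤ Z δ e') → (∀ (y : ℂ) (ρ₀ : ℝ), 0 < ρ₀ → x ∉ Metric.closedBall y (2 * ρ₀) → (y.im = c.im → Metric.closedBall y ρ₀ ⊆ Metric.ball c ρ → ∃ C : ℝ, 0 < C ∧ ∀ᶠ δ : ℝ in 𝓝[>] 0, ∀ k : ℤ, (δ : ℂ) * hexMidpoint s((((![k, m δ - 1] : Site 2)), (1 : Fin 2)), ((![k, m δ] : Site 2), (0 : Fin 2))) ∈ Metric.ball y ρ₀ → C⁻¹ * Z δ (b δ) ≤ Z δ s((((![k, m δ - 1] : Site 2)), (1 : Fin 2)), ((![k, m δ] : Site 2), (0 : Fin 2))) ∧ Z δ s((((![k, m δ - 1] : Site 2)), (1 : Fin 2)), ((![k, m δ] : Site 2), (0 : Fin 2))) ≤ C * Z δ (b δ)) ∧ (y.im = x.im → Metric.closedBall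 y ρ₀ ⊆ Metric.ball x r → ∃ C : ℝ, 0 < C ∧ ∀ᶠ δ : ℝ in 𝓝[>] 0, ∀ k : ℤ, (δ : ℂ) * hexMidpoint s((((![k, mr δ - 1] : Site 2)), (1 : Fin 2)), ((![k, mr δ] : Site 2), (0 : Fin 2))) ∈ Metric.ball y ρ₀ → C⁻¹ * Z δ (b δ) ≤ Z δ s((((![k, mr δ - 1] : Site 2)), (1 : Fin 2)), ((![k, mr δ] : Site 2), (0 : Fin 2))) ∧ Z δ s((((![k, mr δ - 1] : Site 2)), (1 : Fin 2)), ((![k, mr δ] : Site 2), (0 : Fin 2))) ≤ C * Z δ (b δ))) → (∀ (y : ℂ) (ρ₀ : ℝ), 0 < ρ₀ → (y.im = c.im ∧ Metric.closedBall y ρ₀ ⊆ Metric.ball c ρ ∨ y.im = x.im ∧ Metric.closedBall y ρ₀ ⊆ Metric.ball x r) → x ∉ Metric.closedBall y (2 * ρ₀) → ∃ C : ℝ, 0 < C ∧ ∀ ρ' : ℝ, 0 < ρ' → ρ' ≤ ρ₀ → ∀ᶠ δ : ℝ in 𝓝[>] 0, C⁻¹ * ρ' * Z δ (b δ) ≤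 δ * ∑ᶠ e' ∈ {e' : Sym2 HexVertex | e' ∈ hexDomainBoundary (Λ δ) ∧ (δ : ℂ) * hexMidpoint e' ∈ Metric.ball y ρ'}, Z δ e' ∧ δ * ∑ᶠ e' ∈ {e' : Sym2 HexVertex | e' ∈ hexDomainBoundary (Λ δ) ∧ (δ : ℂ) * hexMidpoint e' ∈ Metric.ball y ρ'}, Z δ e' ≤ C * ρ' * Z δ (b δ)) := by
  intro Λ m mr ρ r c x b e Z hρ hpin hb hblim hr hpinr he helim hZ hA y ρ₀ hρ₀ hpiece hxy
  rcases hpiece with ⟨hy, hball⟩ | ⟨hy, hball⟩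
  · exact density_of_pointwise hρ hpin hb hblim hZ hy hball ((hA y ρ₀ hρ₀ hxy).1 hy hball)
  · exact density_of_pointwise hr hpinr he helim hZ hy hball ((hA y ρ₀ hρ₀ hxy).2 hy hball)

/-! ### 14. Glue: `FlatMassLaws` from (a**) and the root-arm divergence (b) -/

/-- **The flat mass laws from (a**) pointwise comparability on both flat pieces and (b) the root-arm
divergence** (FAMILY LEVEL: the conclusion is verbatim the body of
`…Cruxes.BoundaryClosureR.PickHalfPlane.FlatMassLaws` (skeleton r3); the antecedents are (a**) and
(b) under the same binders, with `AdmissibleFamily` / `PinnedFlatRoot` and `Z` written out).  With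
`armDivergence_family hB : (b)` for the harmonic arm bound `hB : (b*)` (file `…GateMassLawsArm.lean`),
`exact flatMassLaws_of_pointwise_of_arm hA (armDivergence_family hB)` closes `stub_flatMassLaws` from
the two registered pointwise sub-stubs. [cite: DuminilCopinSmirnov2012, §3 (the boundary part α of the strip)] -/
theorem flatMassLaws_of_pointwise_of_arm
    (hA : ∀ (D : DobrushinDomain) (ρ : ℝ) (Λ : ℝ → Finset HexVertex) (m : ℝ → ℤ)
      (b : ℝ → Sym2 HexVertex),
      (0 < ρ ∧
      D.carrier ∩ Metric.ball (D.pt 1) ρ = {z : ℂ | (D.pt 1).im < z.im} ∩ Metric.ball (D.pt 1) ρ ∧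
      (∀ᶠ δ : ℝ in 𝓝[>] 0, hexDomainSimplyConnected (Λ δ) ∧ b δ ∈ hexDomainBoundary (Λ δ) ∧
          (hexGraph.induce ((Λ δ : Finset HexVertex) : Set HexVertex)).Preconnected ∧
          (∀ v ∈ Λ δ, (δ : ℂ) * hexCenter v ∈ D.carrier) ∧
          (∀ v : HexVertex, (δ : ℂ) * hexCenter v ∈ Metric.ball (D.pt 1) ρ → (v ∈ Λ δ ↔ m δ ≤ v.1 1))) ∧
      (∀ K : Set ℂ, IsCompact K → K ⊆ D.carrier →
          ∀ᶠ δ : ℝ in 𝓝[>] 0, ∀ v : HexVertex, (δ : ℂ) * hexCenter v ∈ K → v ∈ Λ δ) ∧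
      Tendsto (fun δ : ℝ => (δ : ℂ) * hexMidpoint (b δ)) (𝓝[>] 0) (𝓝 (D.pt 1))) →
      ∀ (x : ℂ) (e : ℝ → Sym2 HexVertex) (r : ℝ) (mr : ℝ → ℤ),
      (0 < r ∧
      D.carrier ∩ Metric.ball x r = {z : ℂ | x.im < z.im} ∩ Metric.ball x r ∧
      (∀ᶠ δ : ℝ in 𝓝[>] 0, e δ ∈ hexDomainBoundary (Λ δ) ∧ Nonempty (HexMidEdgeSAW (Λ δ) (e δ) (b δ)) ∧
          (∀ v : HexVertex, (δ : ℂ) * hexCenter v ∈ Metric.ball x r → (v ∈ Λ δ ↔ mr δ ≤ v.1 1))) ∧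
      Tendsto (fun δ : ℝ => (δ : ℂ) * hexMidpoint (e δ)) (𝓝[>] 0) (𝓝 x)) → x ≠ D.pt 1 →
      ∀ (y : ℂ) (ρ₀ : ℝ), 0 < ρ₀ → x ∉ Metric.closedBall y (2 * ρ₀) →
        (y.im = (D.pt 1).im → Metric.closedBall y ρ₀ ⊆ Metric.ball (D.pt 1) ρ →
          ∃ C : ℝ, 0 < C ∧ ∀ᶠ δ : ℝ in 𝓝[>] 0, ∀ k : ℤ,
            (δ : ℂ) * hexMidpoint s((((![k, m δ - 1] : Site 2)), (1 : Fin 2)), ((![k, m δ] : Site 2), (0 : Fin 2))) ∈ Metric.ball y ρ₀ →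
            C⁻¹ * ‖hexParafermionicObservable (Λ δ) (e δ) hexCriticalFugacity 0 (b δ)‖ ≤
                ‖hexParafermionicObservable (Λ δ) (e δ) hexCriticalFugacity 0 s((((![k, m δ - 1] : Site 2)), (1 : Fin 2)), ((![k, m δ] : Site 2), (0 : Fin 2)))‖ ∧
              ‖hexParafermionicObservable (Λ δ) (e δ) hexCriticalFugacity 0 s((((![k, m δ - 1] : Site 2)), (1 : Fin 2)), ((![k, m δ] : Site 2), (0 : Fin 2)))‖ ≤
                C * ‖hexParafermionicObservable (Λ δ) (e δ) hexCriticalFugacity 0 (b δ)‖) ∧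
        (y.im = x.im → Metric.closedBall y ρ₀ ⊆ Metric.ball x r →
          ∃ C : ℝ, 0 < C ∧ ∀ᶠ δ : ℝ in 𝓝[>] 0, ∀ k : ℤ,
            (δ : ℂ) * hexMidpoint s((((![k, mr δ - 1] : Site 2)), (1 : Fin 2)), ((![k, mr δ] : Site 2), (0 : Fin 2))) ∈ Metric.ball y ρ₀ →
            C⁻¹ * ‖hexParafermionicObservable (Λ δ) (e δ) hexCriticalFugacity 0 (b δ)‖ ≤
                ‖hexParafermionicObservable (Λ δ) (e δ) hexCriticalFugacity 0 s((((![k, mr δ - 1] : Site 2)), (1 : Fin 2)), ((![k, mr δ] : Site 2), (0 : Fin 2)))‖ ∧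
              ‖hexParafermionicObservable (Λ δ) (e δ) hexCriticalFugacity 0 s((((![k, mr δ - 1] : Site 2)), (1 : Fin 2)), ((![k, mr δ] : Site 2), (0 : Fin 2)))‖ ≤
                C * ‖hexParafermionicObservable (Λ δ) (e δ) hexCriticalFugacity 0 (b δ)‖))
    (hB : ∀ (D : DobrushinDomain) (ρ : ℝ) (Λ : ℝ → Finset HexVertex) (m : ℝ → ℤ)
      (b : ℝ → Sym2 HexVertex),
      (0 < ρ ∧
      D.carrier ∩ Metric.ball (D.pt 1) ρ = {z : ℂ | (D.pt 1).im < z.im} ∩ Metric.ball (D.pt 1) ρ ∧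
      (∀ᶠ δ : ℝ in 𝓝[>] 0, hexDomainSimplyConnected (Λ δ) ∧ b δ ∈ hexDomainBoundary (Λ δ) ∧
          (hexGraph.induce ((Λ δ : Finset HexVertex) : Set HexVertex)).Preconnected ∧
          (∀ v ∈ Λ δ, (δ : ℂ) * hexCenter v ∈ D.carrier) ∧
          (∀ v : HexVertex, (δ : ℂ) * hexCenter v ∈ Metric.ball (D.pt 1) ρ → (v ∈ Λ δ ↔ m δ ≤ v.1 1))) ∧
      (∀ K : Set ℂ, IsCompact K → K ⊆ D.carrier →
          ∀ᶠ δ : ℝ in 𝓝[>] 0, ∀ v : HexVertex, (δ : ℂ) * hexCenter v ∈ K → v ∈ Λ δ) ∧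
      Tendsto (fun δ : ℝ => (δ : ℂ) * hexMidpoint (b δ)) (𝓝[>] 0) (𝓝 (D.pt 1))) →
      ∀ (x : ℂ) (e : ℝ → Sym2 HexVertex) (r : ℝ) (mr : ℝ → ℤ),
      (0 < r ∧
      D.carrier ∩ Metric.ball x r = {z : ℂ | x.im < z.im} ∩ Metric.ball x r ∧
      (∀ᶠ δ : ℝ in 𝓝[>] 0, e δ ∈ hexDomainBoundary (Λ δ) ∧ Nonempty (HexMidEdgeSAW (Λ δ) (e δ) (b δ)) ∧
          (∀ v : HexVertex, (δ : ℂ) * hexCenter v ∈ Metric.ball x r → (v ∈ Λ δ ↔ mr δ ≤ v.1 1))) ∧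
      Tendsto (fun δ : ℝ => (δ : ℂ) * hexMidpoint (e δ)) (𝓝[>] 0) (𝓝 x)) → x ≠ D.pt 1 →
      ∀ A : ℝ, ∃ η : ℝ, 0 < η ∧ η < r / 2 ∧ ∀ᶠ δ : ℝ in 𝓝[>] 0,
        A * ‖hexParafermionicObservable (Λ δ) (e δ) hexCriticalFugacity 0 (b δ)‖ ≤
          δ * ∑ᶠ e' ∈ {e' : Sym2 HexVertex | e' ∈ hexDomainBoundary (Λ δ) ∧
            (δ : ℂ) * hexMidpoint e' ∈ Metric.ball x (r / 2) ∧
            x.re + η < ((δ : ℂ) * hexMidpoint e').re},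
            ‖hexParafermionicObservable (Λ δ) (e δ) hexCriticalFugacity 0 e'‖) :
    ∀ (D : DobrushinDomain) (ρ : ℝ) (Λ : ℝ → Finset HexVertex) (m : ℝ → ℤ) (b : ℝ → Sym2 HexVertex),
      (0 < ρ ∧
      D.carrier ∩ Metric.ball (D.pt 1) ρ = {z : ℂ | (D.pt 1).im < z.im} ∩ Metric.ball (D.pt 1) ρ ∧
      (∀ᶠ δ : ℝ in 𝓝[>] 0, hexDomainSimplyConnected (Λ δ) ∧ b δ ∈ hexDomainBoundary (Λ δ) ∧
          (hexGraph.induce ((Λ δ : Finset HexVertex) : Set HexVertex)).Preconnected ∧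
          (∀ v ∈ Λ δ, (δ : ℂ) * hexCenter v ∈ D.carrier) ∧
          (∀ v : HexVertex, (δ : ℂ) * hexCenter v ∈ Metric.ball (D.pt 1) ρ → (v ∈ Λ δ ↔ m δ ≤ v.1 1))) ∧
      (∀ K : Set ℂ, IsCompact K → K ⊆ D.carrier →
          ∀ᶠ δ : ℝ in 𝓝[>] 0, ∀ v : HexVertex, (δ : ℂ) * hexCenter v ∈ K → v ∈ Λ δ) ∧
      Tendsto (fun δ : ℝ => (δ : ℂ) * hexMidpoint (b δ)) (𝓝[>] 0) (𝓝 (D.pt 1))) →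
    ∀ (x : ℂ) (e : ℝ → Sym2 HexVertex) (r : ℝ) (mr : ℝ → ℤ),
      (0 < r ∧
      D.carrier ∩ Metric.ball x r = {z : ℂ | x.im < z.im} ∩ Metric.ball x r ∧
      (∀ᶠ δ : ℝ in 𝓝[>] 0, e δ ∈ hexDomainBoundary (Λ δ) ∧ Nonempty (HexMidEdgeSAW (Λ δ) (e δ) (b δ)) ∧
          (∀ v : HexVertex, (δ : ℂ) * hexCenter v ∈ Metric.ball x r → (v ∈ Λ δ ↔ mr δ ≤ v.1 1))) ∧
      Tendsto (fun δ : ℝ => (δ : ℂ) * hexMidpoint (e δ)) (𝓝[>] 0) (𝓝 x)) → x ≠ D.pt 1 →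
    let Z : ℝ → Sym2 HexVertex → ℝ := fun δ z =>
      ‖hexParafermionicObservable (Λ δ) (e δ) hexCriticalFugacity 0 z‖
    (∀ (y : ℂ) (ρ₀ : ℝ), 0 < ρ₀ →
        (y.im = (D.pt 1).im ∧ Metric.closedBall y ρ₀ ⊆ Metric.ball (D.pt 1) ρ ∨
          y.im = x.im ∧ Metric.closedBall y ρ₀ ⊆ Metric.ball x r) →
        x ∉ Metric.closedBall y (2 * ρ₀) →
      ∃ C : ℝ, 0 < C ∧ ∀ ρ' : ℝ, 0 < ρ' → ρ' ≤ ρ₀ → ∀ᶠ δ : ℝ in 𝓝[>] 0,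
        C⁻¹ * ρ' * Z δ (b δ) ≤ δ * ∑ᶠ e' ∈ {e' : Sym2 HexVertex | e' ∈ hexDomainBoundary (Λ δ) ∧
            (δ : ℂ) * hexMidpoint e' ∈ Metric.ball y ρ'}, Z δ e' ∧
        δ * ∑ᶠ e' ∈ {e' : Sym2 HexVertex | e' ∈ hexDomainBoundary (Λ δ) ∧
            (δ : ℂ) * hexMidpoint e' ∈ Metric.ball y ρ'}, Z δ e' ≤ C * ρ' * Z δ (b δ)) ∧
    (∀ A : ℝ, ∃ η : ℝ, 0 < η ∧ η < r / 2 ∧ ∀ᶠ δ : ℝ in 𝓝[>] 0,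
        A * Z δ (b δ) ≤ δ * ∑ᶠ e' ∈ {e' : Sym2 HexVertex | e' ∈ hexDomainBoundary (Λ δ) ∧
            (δ : ℂ) * hexMidpoint e' ∈ Metric.ball x (r / 2) ∧
            x.re + η < ((δ : ℂ) * hexMidpoint e').re}, Z δ e') := by
  intro D ρ Λ m b hAF x e r mr hPR hx
  refine ⟨?_, hB D ρ Λ m b hAF x e r mr hPR hx⟩
  have hpin : ∀ᶠ δ : ℝ in 𝓝[>] 0, ∀ v : HexVertex,
      (δ : ℂ) * hexCenter v ∈ Metric.ball (D.pt 1) ρ → (v ∈ Λ δ ↔ m δ ≤ v.1 1) :=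
    hAF.2.2.1.mono fun δ hδ => hδ.2.2.2.2
  have hb : ∀ᶠ δ : ℝ in 𝓝[>] 0, b δ ∈ hexDomainBoundary (Λ δ) :=
    hAF.2.2.1.mono fun δ hδ => hδ.2.1
  have hpinr : ∀ᶠ δ : ℝ in 𝓝[>] 0, ∀ v : HexVertex,
      (δ : ℂ) * hexCenter v ∈ Metric.ball x r → (v ∈ Λ δ ↔ mr δ ≤ v.1 1) :=
    hPR.2.2.1.mono fun δ hδ => hδ.2.2
  have he : ∀ᶠ δ : ℝ in 𝓝[>] 0, e δ ∈ hexDomainBoundary (Λ δ) := hPR.2.2.1.mono fun δ hδ => hδ.1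
  exact stub_flatMassLaws_densityReduction Λ m mr ρ r (D.pt 1) x b e
    (fun δ z => ‖hexParafermionicObservable (Λ δ) (e δ) hexCriticalFugacity 0 z‖)
    hAF.1 hpin hb hAF.2.2.2.2 hPR.1 hpinr he hPR.2.2.2 (fun _ _ => norm_nonneg _)
    (hA D ρ Λ m b hAF x e r mr hPR hx)

end Summit.CriticalPhenomena.SAWScalingLimit.Theorems.PickHalfPlane.GateMass

end
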